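import Literature.Probability.Percolation.ArmSeparationOutExtFour
import HarnessLib

/-!
# Four ADJACENT arms landed on the sides `0, 2 | 3, 5`: the events, and outward extension at constant cost at `p`

Topic `Literature/Probability/Percolation`; family `crit-perc` / near-critical percolation on `𝕋`.
First brick of the near-critical arm-separation theorem for four arms in the ADJACENT colour
arrangement (P. Nolin, *Near-critical percolation in two dimensions*, EJP 13 (2008), Thm. 11 for
`j = 4`, `σ = BBWW` [arXiv 0711.4948: Thm. 10]; H. Kesten, CMP 109 (1987), Lemmas 4–6), the last
missing input (`hsepAdj`) of the tree's proof of Werner's Lemma 6.3 for the order-free `π̂_t`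
(`Werner2009_lemma63_of_altSeparation_of_adjSeparation`, `ArcFourArmStability.lean`). It is the
adjacent twin of `ArmSeparationExtFourArmQ.lean` + `ArmSeparationOutExtFour.lean` (alternating
colours), with ONE difference of substance: two CONSECUTIVE arms now have the same colour, so the
landed events must record that the two open (closed) arms are DISJOINT — for alternating colours
this is automatic (and recovered by the Hex lemma, `hexQ_open_excl`); here it is carried by
disjoint confining sets of sites, as in `sepArmDuo` (`SepFourAdj.lean`).

**Landing pattern.** The open arms land on the sides `0`, `2` and the closed arms on the sides
`3`, `5` of `∂Λ_N` (the box-preserving frames `frameIso 0 = id`, `frameIso 2 = σ`,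
`frameIso 3 = -id`, `frameIso 5 = -σ` of `ArmSeparationInnerFrames.lean`); in the anticlockwise
order `0, 2, 3, 5` the colours read `B B W W`.

* `extOpenDuoQ n N` — **two disjoint open arms from `∂Λ_n` landed with outer free spaces on the
  sides `0` and `2` of `∂Λ_N`**: disjoint sets of sites `X`, `Y` with `ω ∩ X ∈ extOpenArm n N` (an
  arm landed on the right using only open sites of `X`) and `frameConfig 2 (ω ∩ Y) ∈ extOpenArm n N`;
* `extClosedDuoQ n N := {ω | frameConfig 3 ωᶜ ∈ extOpenDuoQ n N}` — two disjoint closed arms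
  landed on the sides `3`, `5` (`frameConfig 2 ∘ frameConfig 3 = frameConfig 5`);
  `extFourAdjQ n N := extOpenDuoQ n N ∩ extClosedDuoQ n N` — Nolin's `Ã̃^{·/η',I'}_{4,BBWW}(n, N)`,
  `η' = 1/64`, landing areas the middle halves of the sides `0, 2` (open), `3, 5` (closed);
* `sepOpenDuoQ`, `sepFourAdjQ` — the same with inner free spaces as well (`sepOpenArm`);
* monotonicity, `extOpenDuoQ_mono` (longer arms contain shorter ones), locality
  (`determinedBy_extOpenDuoQ`), measurability;
* `extOpenDuoQ_inter_corr_subset` — **deterministic outward extension of the open pair along the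
  two bent corridors** (`sepOutCorrQ R R'` in the frames `0` and `2`): the confining sets are first
  cut down to the cone supports of the two sides (`mem_extOpenArm_iff_inter_cone`) and then enlarged
  by the corridor sites of their own cone; the cones of the sides `0` and `2` beyond `Λ_R` are
  disjoint, so the extended arms are still disjoint (`extOpenArm_inter_sepOutCorrQ_subset` per arm);
* `real_extFourAdjQ_mul_le_outward_at` — **`P_p(extFourAdjQ n R) · (c^95)⁴ ≤ P_p(extFourAdjQ n R')`**
  for `2200 ≤ R`, `2n ≤ R`, `2R ≤ R' ≤ 32R`, `R' ≤ Ncap`, from crossing probabilities `≥ c` at `p`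
  and `1 - p` for boxes of aspect ratio `ρ ≥ 64` and height `≤ Ncap` (Nolin's Lemma 13,
  `triSitePercolation_locallyMonotone_fkg`, with the shared shell `{n ≤ |v| ≤ R}`, the INCREASING
  region = cones of the sides `0, 2` beyond `Λ_R`, the DECREASING region = cones of the sides
  `3, 5`; Harris at `p` for the two open corridors and at `1 - p` for the two closed ones).

Everything here is proved; no named facts are introduced.

## References

* P. Nolin, Near-critical percolation in two dimensions, *Electron. J. Probab.* 13 (2008), §4.2
  Def. 6–8, §4.3 Prop. 12 (i) and Lemma 13, §4.4 (arXiv 0711.4948: Def. 6–8, Prop. 11, Lemma 12,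
  proof of Thm. 10, p. 12) [Nolin2008].
* H. Kesten, Scaling relations for 2D-percolation, *Comm. Math. Phys.* 109 (1987), Lemma 2,
  Lemmas 4–6 [Kesten1987].
* W. Werner, *Lectures on two-dimensional critical percolation*, PCMI 16 (2009), Lecture 6, §4
  (first exercise session: separation of arms) and Lemma 6.3 [WernerPCMI2009].

Tree: `extOpenArm`, `isUpperSet_extOpenArm`, `extOpenArm_mono`, `sepOpenArm`,
`sepOpenArm_subset_extOpenArm` (`ArmSeparationExtArm.lean`); `extConeSet`,
`mem_extOpenArm_iff_inter_cone`, `determinedBy_extOpenArm_cone`, `sepOutCorrQ`,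
`sepOutCorrQFinset`, `sepOutCorrQFinset_subset`, `determinedBy_sepOutCorrQ`,
`isUpperSet_sepOutCorrQ`, `le_real_sepOutCorrQ_at`, `extOpenArm_inter_sepOutCorrQ_subset`
(`ArmSeparationOutExtFour.lean`); `frameIso`, `frameConfig`, `frameIso_apply_formula`,
`triNorm_frameIso`, `frameIso_two_two`, `frameConfig_two_three`, `real_preimage_frameConfig`,
`frameConfig_mono`, `determinedBy_preimage_frameConfig`, `DeterminedBy.preimage_compl'`;
`triSitePercolation_locallyMonotone_fkg`, `sitePercolation_harris'`,
`sitePercolation_real_preimage_compl`.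
-/

noncomputable section

open MeasureTheory Set

namespace Literature.Probability.Percolation

open LatticeModels

/-! ### The events -/

/-- **Two disjoint open arms from `∂Λ_n` landed on the sides `0` and `2` of `∂Λ_N`** (outer free
spaces only): disjoint confining sets `X`, `Y` such that the configuration restricted to `X` has an
open arm landed on the right side and the configuration restricted to `Y`, read through the
transposition `frameIso 2 = σ`, has an open arm landed on the right side (i.e. `ω` has an open arm
landed on the top side `2` using only sites of `Y`). [cite: Nolin2008, §4.2 Def. 6–8 and §4.4 (arXiv 0711.4948: Def. 6–8; proof of Thm. 10, p. 13), σ = BBWW] -/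
def extOpenDuoQ (n N : ℕ) : Set (SiteConfig (Site 2)) :=
  {ω | ∃ X Y : Set (Site 2), Disjoint X Y ∧ ω ∩ X ∈ extOpenArm n N ∧ frameConfig 2 (ω ∩ Y) ∈ extOpenArm n N}

/-- **Two disjoint closed arms landed on the sides `3` and `5`**: the open pair of the
colour-exchanged configuration read through the central symmetry `frameIso 3 = -id`
(`frameConfig 2 ∘ frameConfig 3 = frameConfig 5`). [cite: Nolin2008, §4.2 Def. 6–8 and §4.4 (arXiv 0711.4948: Def. 6–8), σ = BBWW] -/
def extClosedDuoQ (n N : ℕ) : Set (SiteConfig (Site 2)) :=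
  {ω | frameConfig 3 ωᶜ ∈ extOpenDuoQ n N}

/-- **Four arms in the adjacent arrangement landed on the sides `0, 2` (open) and `3, 5` (closed)
of `∂Λ_N` with outer free spaces**, Nolin's `Ã̃^{·/η',I'}_{4,BBWW}(n, N)` with `η' = 1/64`. [cite: Nolin2008, §4.2 Def. 6–8 and §4.4 (arXiv 0711.4948: Def. 6–8; proof of Thm. 10, p. 13), σ = BBWW] -/
def extFourAdjQ (n N : ℕ) : Set (SiteConfig (Site 2)) := extOpenDuoQ n N ∩ extClosedDuoQ n N

/-- Two disjoint fenced open arms (inner AND outer free spaces) landing on the sides `0`, `2`. [cite: Nolin2008, §4.2 Def. 6–8 (arXiv 0711.4948: Def. 6–8), σ = BBWW] -/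
def sepOpenDuoQ (n N : ℕ) : Set (SiteConfig (Site 2)) :=
  {ω | ∃ X Y : Set (Site 2), Disjoint X Y ∧ ω ∩ X ∈ sepOpenArm n N ∧ frameConfig 2 (ω ∩ Y) ∈ sepOpenArm n N}

/-- **The well-separated four-arm event with adjacent colours on the sides `0, 2 | 3, 5`**, Nolin's
`Ã̃^{η,I/η',I'}_{4,BBWW}(n, N)` with `η = η' = 1/64`. [cite: Nolin2008, §4.2 Def. 8 and §4.3 Thm. 11 (arXiv 0711.4948: Def. 7, Thm. 10), σ = BBWW] -/
def sepFourAdjQ (n N : ℕ) : Set (SiteConfig (Site 2)) :=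
  sepOpenDuoQ n N ∩ {ω | frameConfig 3 ωᶜ ∈ sepOpenDuoQ n N}

/-! ### Elementary properties -/

/-- Framing a restricted configuration: `frameConfig i (ω ∩ Y) = frameConfig i ω ∩ (frameIso i)⁻¹' Y`. [folklore] -/
theorem frameConfig_inter (i : ℕ) (ω : SiteConfig (Site 2)) (Y : Set (Site 2)) :
    frameConfig i (ω ∩ Y) = frameConfig i ω ∩ {v | frameIso i v ∈ Y} := by
  ext v; simp only [mem_frameConfig, Set.mem_inter_iff, Set.mem_setOf_eq]

/-- The doubly fenced pair is landed at the outer end (`2n ≤ N`). [folklore] -/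
theorem sepOpenDuoQ_subset_extOpenDuoQ {n N : ℕ} (hnN : 2 * n ≤ N) : sepOpenDuoQ n N ⊆ extOpenDuoQ n N :=
  fun _ ⟨X, Y, hXY, hX, hY⟩ => ⟨X, Y, hXY, sepOpenArm_subset_extOpenArm hnN hX, sepOpenArm_subset_extOpenArm hnN hY⟩

/-- The doubly fenced four arms are landed at the outer end (`2n ≤ N`). [folklore] -/
theorem sepFourAdjQ_subset_extFourAdjQ {n N : ℕ} (hnN : 2 * n ≤ N) : sepFourAdjQ n N ⊆ extFourAdjQ n N :=
  fun _ ⟨h, h'⟩ => ⟨sepOpenDuoQ_subset_extOpenDuoQ hnN h, sepOpenDuoQ_subset_extOpenDuoQ hnN h'⟩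

/-- The open pair is an increasing event. [folklore] -/
theorem isUpperSet_extOpenDuoQ (n N : ℕ) : IsUpperSet (extOpenDuoQ n N) := by
  rintro ω ω' hle ⟨X, Y, hXY, hX, hY⟩
  refine ⟨X, Y, hXY, isUpperSet_extOpenArm n N (Set.inter_subset_inter_left X hle) hX,
    isUpperSet_extOpenArm n N (frameConfig_mono 2 (Set.inter_subset_inter_left Y hle)) hY⟩

/-- The closed pair is a decreasing event. [folklore] -/
theorem isLowerSet_extClosedDuoQ (n N : ℕ) : IsLowerSet (extClosedDuoQ n N) := by
  intro ω ω' hle hω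
  exact isUpperSet_extOpenDuoQ n N (frameConfig_mono 3 (Set.compl_subset_compl.2 hle)) hω

/-- **Longer arms contain shorter ones**: `extOpenDuoQ n N ⊆ extOpenDuoQ n' N` for `n ≤ n' ≤ N`. [folklore] -/
theorem extOpenDuoQ_mono {n n' N : ℕ} (hnn' : n ≤ n') (hn'N : n' ≤ N) : extOpenDuoQ n N ⊆ extOpenDuoQ n' N :=
  fun _ ⟨X, Y, hXY, hX, hY⟩ => ⟨X, Y, hXY, extOpenArm_mono hnn' hn'N hX, extOpenArm_mono hnn' hn'N hY⟩

/-- `extFourAdjQ n N ⊆ extFourAdjQ n' N` for `n ≤ n' ≤ N`. [folklore] -/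
theorem extFourAdjQ_mono {n n' N : ℕ} (hnn' : n ≤ n') (hn'N : n' ≤ N) : extFourAdjQ n N ⊆ extFourAdjQ n' N :=
  fun _ ⟨h, h'⟩ => ⟨extOpenDuoQ_mono hnn' hn'N h, extOpenDuoQ_mono hnn' hn'N h'⟩

/-! ### Locality -/

/-- **The cone support of the open pair**: the cone supports of the sides `0` and `2`. [cite: Nolin2008, §4.2 Def. 6 (arXiv 0711.4948)] -/
def extDuoConeSet (n N : ℕ) : Set (Site 2) := extConeSet n N ∪ {v | frameIso 2 v ∈ extConeSet n N}

/-- **Normalisation of the confining sets to the cone supports.** [folklore] -/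
theorem mem_extOpenDuoQ_iff {n N : ℕ} (hnN : 2 * n ≤ N) (ω : SiteConfig (Site 2)) :
    ω ∈ extOpenDuoQ n N ↔ ∃ X Y : Set (Site 2), Disjoint X Y ∧ X ⊆ extConeSet n N ∧
      Y ⊆ {v | frameIso 2 v ∈ extConeSet n N} ∧ ω ∩ X ∈ extOpenArm n N ∧ frameConfig 2 (ω ∩ Y) ∈ extOpenArm n N := by
  constructor
  · rintro ⟨X, Y, hXY, hX, hY⟩
    refine ⟨X ∩ extConeSet n N, Y ∩ {v | frameIso 2 v ∈ extConeSet n N},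
      hXY.mono Set.inter_subset_left Set.inter_subset_left, Set.inter_subset_right, Set.inter_subset_right, ?_, ?_⟩
    · rw [← Set.inter_assoc]; exact (mem_extOpenArm_iff_inter_cone hnN _).1 hX
    · have h := (mem_extOpenArm_iff_inter_cone hnN _).1 hY
      rw [frameConfig_inter] at h ⊢
      convert h using 1
      ext v; simp only [Set.mem_inter_iff, Set.mem_setOf_eq, frameIso_two_two]; tauto
  · rintro ⟨X, Y, hXY, -, -, hX, hY⟩
    exact ⟨X, Y, hXY, hX, hY⟩

/-- **Locality of the open pair in the two cones** (`2n ≤ N`). [folklore] -/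
theorem determinedBy_extOpenDuoQ {n N : ℕ} (hnN : 2 * n ≤ N) : DeterminedBy (extOpenDuoQ n N) (extDuoConeSet n N) := by
  rw [determinedBy_iff]
  suffices key : ∀ ω ω' : SiteConfig (Site 2), ω ∩ extDuoConeSet n N = ω' ∩ extDuoConeSet n N →
      ω ∈ extOpenDuoQ n N → ω' ∈ extOpenDuoQ n N from
    fun ω ω' h => ⟨key ω ω' h, key ω' ω h.symm⟩
  intro ω ω' h hω
  obtain ⟨X, Y, hXY, hXc, hYc, hX, hY⟩ := (mem_extOpenDuoQ_iff hnN ω).1 hω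
  have hXe : ω' ∩ X = ω ∩ X := by
    ext v
    constructor
    · rintro ⟨hv, hvX⟩
      have : v ∈ ω' ∩ extDuoConeSet n N := ⟨hv, Or.inl (hXc hvX)⟩
      rw [← h] at this; exact ⟨this.1, hvX⟩
    · rintro ⟨hv, hvX⟩
      have : v ∈ ω ∩ extDuoConeSet n N := ⟨hv, Or.inl (hXc hvX)⟩
      rw [h] at this; exact ⟨this.1, hvX⟩
  have hYe : ω' ∩ Y = ω ∩ Y := by
    ext v
    constructor
    · rintro ⟨hv, hvY⟩
      have : v ∈ ω' ∩ extDuoConeSet n N := ⟨hv, Or.inr (hYc hvY)⟩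
      rw [← h] at this; exact ⟨this.1, hvY⟩
    · rintro ⟨hv, hvY⟩
      have : v ∈ ω ∩ extDuoConeSet n N := ⟨hv, Or.inr (hYc hvY)⟩
      rw [h] at this; exact ⟨this.1, hvY⟩
  refine ⟨X, Y, hXY, ?_, ?_⟩
  · rw [hXe]; exact hX
  · rw [hYe]; exact hY

/-- The support of the open pair at scale `R`, inside the shell `{n ≤ |v| ≤ R}` and the cones of the
sides `0, 2` beyond it, as used by Lemma 13 (`2n ≤ R`, `R ≤ R'`). [folklore] -/
theorem extDuoConeSet_subset {n R R' : ℕ} (hRR' : R ≤ R') :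
    extDuoConeSet n R ⊆ ↑((triBall R).filter fun v => (n : ℤ) ≤ triNorm v) ∪
      ↑((triBall (R' + R' / 8)).filter fun v : Site 2 =>
        (R : ℤ) < triNorm v ∧ ((v 1 ≤ 0 ∧ 0 < v 0 + v 1) ∨ (v 0 ≤ 0 ∧ 0 < v 0 + v 1))) := by
  have h88 : (R : ℤ) + (R / 8 : ℕ) ≤ (R' : ℤ) + (R' / 8 : ℕ) := by have := Nat.div_le_div_right (c := 8) hRR'; omega
  rintro v (hv | hv)
  · rw [mem_extConeSet] at hv
    simp only [Set.mem_union, Finset.mem_coe, Finset.mem_filter, mem_triBall_iff]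
    by_cases h : triNorm v ≤ (R : ℤ)
    · exact Or.inl ⟨h, hv.1⟩
    · right
      have hc := hv.2.2 (by omega)
      exact ⟨by push_cast; omega, by omega, Or.inl ⟨by omega, hc.2⟩⟩
  · simp only [Set.mem_setOf_eq, mem_extConeSet] at hv
    obtain ⟨-, -, -, -, f20, f21, -⟩ := frameIso_apply_formula v
    rw [triNorm_frameIso 2 (by norm_num), f20, f21] at hv
    simp only [Set.mem_union, Finset.mem_coe, Finset.mem_filter, mem_triBall_iff]
    by_cases h : triNorm v ≤ (R : ℤ)
    · exact Or.inl ⟨h, hv.1⟩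
    · right
      have hc := hv.2.2 (by omega)
      exact ⟨by push_cast; omega, by omega, Or.inr ⟨by omega, by omega⟩⟩

/-- The open pair is measurable (`2n ≤ N`). [folklore] -/
theorem measurableSet_extOpenDuoQ {n N : ℕ} (hnN : 2 * n ≤ N) : MeasurableSet (extOpenDuoQ n N) := by
  have h := (determinedBy_extOpenDuoQ hnN).mono (extDuoConeSet_subset (n := n) (R := N) le_rfl)
  rw [← Finset.coe_union] at h
  exact h.measurableSet_of_finset

/-- The closed pair is measurable (`2n ≤ N`). [folklore] -/
theorem measurableSet_extClosedDuoQ {n N : ℕ} (hnN : 2 * n ≤ N) : MeasurableSet (extClosedDuoQ n N) := by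
  have h1 := determinedBy_preimage_frameConfig 3
    ((determinedBy_extOpenDuoQ hnN).mono (extDuoConeSet_subset (n := n) (R := N) le_rfl))
  have h2 := DeterminedBy.preimage_compl' h1
  rw [← Finset.coe_union, ← Finset.coe_image] at h2
  exact h2.measurableSet_of_finset

/-- The adjacent four-arm landed event is measurable (`2n ≤ N`). [folklore] -/
theorem measurableSet_extFourAdjQ {n N : ℕ} (hnN : 2 * n ≤ N) : MeasurableSet (extFourAdjQ n N) :=
  (measurableSet_extOpenDuoQ hnN).inter (measurableSet_extClosedDuoQ hnN)

/-! ### Deterministic outward extension of the pair -/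

/-- **Outward extension of the two disjoint open arms along the bent corridors of the sides `0`
and `2`**: `extOpenDuoQ n R ∩ (C ∩ {frameConfig 2 ω ∈ C}) ⊆ extOpenDuoQ n R'`, `C = sepOutCorrQ R R'`
(`2200 ≤ R`, `2n ≤ R`, `2R ≤ R' ≤ 32R`). The confining sets are cut down to the cone supports and
enlarged by the corridor sites of their own side; the corridor of the side `0` lies beyond `Λ_R` in
the cone `{x₁ ≤ 0 < x₀ + x₁}`, that of the side `2` in `{x₀ ≤ 0 < x₀ + x₁}`, and these are disjoint
from each other and from the other side's cone support, so the extended arms are disjoint. [cite: Nolin2008, §4.3 Prop. 12 (i) (proof) (arXiv 0711.4948: Prop. 11); §4.4 p. 12 (constant C₀), σ = BBWW] -/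
theorem extOpenDuoQ_inter_corr_subset {n R R' : ℕ} (hR : 2200 ≤ R) (hnR : 2 * n ≤ R) (hRR' : 2 * R ≤ R')
    (hR'R : R' ≤ 32 * R) :
    extOpenDuoQ n R ∩ (sepOutCorrQ R R' ∩ {ω | frameConfig 2 ω ∈ sepOutCorrQ R R'}) ⊆ extOpenDuoQ n R' := by
  rintro ω ⟨hω, g0, g2⟩
  simp only [Set.mem_setOf_eq] at g2
  obtain ⟨X, Y, hXY, hXc, hYc, hX, hY⟩ := (mem_extOpenDuoQ_iff hnR ω).1 hω
  set F₀ : Set (Site 2) := ↑(sepOutCorrQFinset R R') with hF₀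
  have dC := determinedBy_sepOutCorrQ R R'
  rw [determinedBy_iff] at dC
  -- the new confining sets
  set X₁ : Set (Site 2) := X ∪ F₀ with hX₁
  set Y₁ : Set (Site 2) := Y ∪ {v | frameIso 2 v ∈ F₀} with hY₁
  refine ⟨X₁, Y₁, ?_, ?_, ?_⟩
  · -- disjointness
    rw [Set.disjoint_left]
    rintro v (hvX | hvF) (hvY | hvF')
    · exact Set.disjoint_left.1 hXY hvX hvY
    · -- `v ∈ extConeSet`, `σ v` a corridor site
      have h1 := mem_extConeSet.1 (hXc hvX)
      have h2 := sepOutCorrQFinset_subset hR hRR' hR'R (Finset.mem_coe.1 hvF')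
      obtain ⟨-, -, -, -, f20, f21, -⟩ := frameIso_apply_formula v
      rw [triNorm_frameIso 2 (by norm_num), f20, f21] at h2
      have h3 := h1.2.2 (by omega)
      omega
    · have h1 := sepOutCorrQFinset_subset hR hRR' hR'R (Finset.mem_coe.1 hvF)
      have h2 := mem_extConeSet.1 (hYc hvY)
      obtain ⟨-, -, -, -, f20, f21, -⟩ := frameIso_apply_formula v
      rw [triNorm_frameIso 2 (by norm_num), f20, f21] at h2
      have h3 := h2.2.2 (by omega)
      omega
    · have h1 := sepOutCorrQFinset_subset hR hRR' hR'R (Finset.mem_coe.1 hvF)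
      have h2 := sepOutCorrQFinset_subset hR hRR' hR'R (Finset.mem_coe.1 hvF')
      obtain ⟨-, -, -, -, f20, f21, -⟩ := frameIso_apply_formula v
      rw [f20, f21] at h2
      omega
  · -- the arm of the side `0`
    have hsub : ω ∩ X ⊆ ω ∩ X₁ := Set.inter_subset_inter_right _ Set.subset_union_left
    have hE : ω ∩ X₁ ∈ extOpenArm n R := isUpperSet_extOpenArm n R hsub hX
    have hC : ω ∩ X₁ ∈ sepOutCorrQ R R' := by
      refine (dC (ω ∩ X₁) ω ?_).2 g0
      ext v; simp only [Set.mem_inter_iff]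
      exact ⟨fun h => ⟨h.1.1, h.2⟩, fun h => ⟨⟨h.1, Or.inr h.2⟩, h.2⟩⟩
    exact extOpenArm_inter_sepOutCorrQ_subset hR hnR hRR' hR'R ⟨hE, hC⟩
  · -- the arm of the side `2`, in the frame `2`
    rw [frameConfig_inter] at hY ⊢
    have hpre : {v : Site 2 | frameIso 2 v ∈ Y₁} = {v | frameIso 2 v ∈ Y} ∪ F₀ := by
      ext v
      simp only [hY₁, Set.mem_setOf_eq, Set.mem_union, frameIso_two_two]
    rw [hpre]
    set χ := frameConfig 2 ω with hχ
    have hsub : χ ∩ {v | frameIso 2 v ∈ Y} ⊆ χ ∩ ({v | frameIso 2 v ∈ Y} ∪ F₀) :=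
      Set.inter_subset_inter_right _ Set.subset_union_left
    have hE : χ ∩ ({v | frameIso 2 v ∈ Y} ∪ F₀) ∈ extOpenArm n R := isUpperSet_extOpenArm n R hsub hY
    have hC : χ ∩ ({v | frameIso 2 v ∈ Y} ∪ F₀) ∈ sepOutCorrQ R R' := by
      refine (dC _ χ ?_).2 g2
      ext v; simp only [Set.mem_inter_iff]
      exact ⟨fun h => ⟨h.1.1, h.2⟩, fun h => ⟨⟨h.1, Or.inr h.2⟩, h.2⟩⟩
    exact extOpenArm_inter_sepOutCorrQ_subset hR hnR hRR' hR'R ⟨hE, hC⟩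

/-- **Outward extension of the two disjoint closed arms** along the corridors of the sides `3`, `5`
(the open statement for `frameConfig 3 ωᶜ`; `frameConfig 2 ∘ frameConfig 3 = frameConfig 5`). [cite: Nolin2008, §4.3 Prop. 12 (i) (proof) (arXiv 0711.4948: Prop. 11), σ = BBWW] -/
theorem extClosedDuoQ_inter_corr_subset {n R R' : ℕ} (hR : 2200 ≤ R) (hnR : 2 * n ≤ R) (hRR' : 2 * R ≤ R')
    (hR'R : R' ≤ 32 * R) :
    extClosedDuoQ n R ∩ ({ω | frameConfig 3 ωᶜ ∈ sepOutCorrQ R R'} ∩ {ω | frameConfig 5 ωᶜ ∈ sepOutCorrQ R R'}) ⊆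
      extClosedDuoQ n R' := by
  rintro ω ⟨hω, g3, g5⟩
  simp only [Set.mem_setOf_eq] at g3 g5
  rw [← frameConfig_two_three] at g5
  exact extOpenDuoQ_inter_corr_subset hR hnR hRR' hR'R ⟨hω, g3, g5⟩

/-- **Outward extension of the four adjacent landed arms** along the four corridors. [cite: Nolin2008, §4.3 Prop. 12 (i) (proof) (arXiv 0711.4948: Prop. 11), σ = BBWW] -/
theorem extFourAdjQ_inter_corr_subset {n R R' : ℕ} (hR : 2200 ≤ R) (hnR : 2 * n ≤ R) (hRR' : 2 * R ≤ R')
    (hR'R : R' ≤ 32 * R) :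
    extFourAdjQ n R ∩ ((sepOutCorrQ R R' ∩ {ω | frameConfig 2 ω ∈ sepOutCorrQ R R'}) ∩
      ({ω | frameConfig 3 ωᶜ ∈ sepOutCorrQ R R'} ∩ {ω | frameConfig 5 ωᶜ ∈ sepOutCorrQ R R'})) ⊆ extFourAdjQ n R' := by
  rintro ω ⟨⟨hO, hCl⟩, gO, gCl⟩
  exact ⟨extOpenDuoQ_inter_corr_subset hR hnR hRR' hR'R ⟨hO, gO⟩,
    extClosedDuoQ_inter_corr_subset hR hnR hRR' hR'R ⟨hCl, gCl⟩⟩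

/-! ### The extension inequality at `p` -/

/-- **Outward extension of the four adjacent landed arms at constant cost, at `p`** (Nolin 2008,
Prop. 12 (i) on the external boundary via Lemma 13; §4.4 p. 12, the constant `C₀`; `σ = BBWW`):
with the RSW input `hrsw` at `p` and at `1 - p` (aspect ratio `ρ ≥ 64`, heights `≤ Ncap`), for
`2200 ≤ R`, `2n ≤ R`, `2R ≤ R' ≤ 32R`, `R' ≤ Ncap`:
`P_p(extFourAdjQ n R) · (c^95)⁴ ≤ P_p(extFourAdjQ n R')`. Nolin's Lemma 13
(`triSitePercolation_locallyMonotone_fkg`) with the shared shell `{n ≤ |v| ≤ R}`, the increasing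
region `{R < |v|} ∩ (cone 0 ∪ cone 2)` (the open pair's free spaces and bent corridors) and the
decreasing region `{R < |v|} ∩ (cone 3 ∪ cone 5)` (the closed pair's), Harris at `p` for the two
open corridors and at `1 - p` for the two closed ones, and the deterministic gluing. [cite: Nolin2008, §4.3 Prop. 12 (i) and Lemma 13 (arXiv 0711.4948: Prop. 11, Lemma 12); §4.4 p. 12, σ = BBWW] -/
theorem real_extFourAdjQ_mul_le_outward_at (p : unitInterval) {c : ℝ} {ρ Ncap : ℕ}
    (hrsw : ∀ q : unitInterval, (q = p ∨ q = unitInterval.symm p) →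
      ∀ k : ℕ, 1 ≤ ⌊(ρ : ℝ) * k⌋₊ → k ≤ Ncap → c ≤ triLRCrossingProb q ⌊(ρ : ℝ) * k⌋₊ k)
    (hρ : 64 ≤ ρ) (hc : 0 ≤ c) {n R R' : ℕ} (hR : 2200 ≤ R) (hnR : 2 * n ≤ R) (hRR' : 2 * R ≤ R') (hR'R : R' ≤ 32 * R)
    (hcap : R' ≤ Ncap) :
    (triSitePercolation p).real (extFourAdjQ n R) * (c ^ 95) ^ 4 ≤ (triSitePercolation p).real (extFourAdjQ n R') := by
  classical
  set C := sepOutCorrQ R R' with hC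
  -- the three pairwise disjoint regions of Nolin's Lemma 13
  set S : Finset (Site 2) := (triBall R).filter (fun v => (n : ℤ) ≤ triNorm v) with hS
  set P : Finset (Site 2) := (triBall (R' + R' / 8)).filter
    (fun v => (R : ℤ) < triNorm v ∧ ((v 1 ≤ 0 ∧ 0 < v 0 + v 1) ∨ (v 0 ≤ 0 ∧ 0 < v 0 + v 1))) with hP
  set M : Finset (Site 2) := (triBall (R' + R' / 8)).filter
    (fun v => (R : ℤ) < triNorm v ∧ ((0 ≤ v 1 ∧ v 0 + v 1 < 0) ∨ (0 ≤ v 0 ∧ v 0 + v 1 < 0))) with hM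
  have hSP : Disjoint S P := by
    rw [Finset.disjoint_left]; intro v hvS hvP
    simp only [hS, hP, Finset.mem_filter, mem_triBall_iff] at hvS hvP
    omega
  have hSM : Disjoint S M := by
    rw [Finset.disjoint_left]; intro v hvS hvM
    simp only [hS, hM, Finset.mem_filter, mem_triBall_iff] at hvS hvM
    omega
  have hPM : Disjoint P M := by
    rw [Finset.disjoint_left]; intro v hvP hvM
    simp only [hP, hM, Finset.mem_filter] at hvP hvM
    omega
  have hRR : 2 * (R : ℤ) ≤ R' := by exact_mod_cast hRR'
  -- supports of the corridors: frames `0, 2` in `P`, frames `3, 5` in `M`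
  have corrSup : ∀ (i : ℕ) (hi : i < 6), (i = 0 ∨ i = 2 → frameIso i '' ↑(sepOutCorrQFinset R R') ⊆ ↑P) ∧
      (i = 3 ∨ i = 5 → frameIso i '' ↑(sepOutCorrQFinset R R') ⊆ ↑M) := by
    intro i hi
    constructor
    · rintro hi0 v ⟨u, hu, rfl⟩
      have h := sepOutCorrQFinset_subset hR hRR' hR'R (Finset.mem_coe.1 hu)
      obtain ⟨f00, f01, -, -, f20, f21, -⟩ := frameIso_apply_formula u
      simp only [hP, Finset.mem_coe, Finset.mem_filter, mem_triBall_iff, triNorm_frameIso i hi]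
      push_cast
      refine ⟨h.2.1, h.1, ?_⟩
      rcases hi0 with rfl | rfl
      · left; rw [f00, f01]; omega
      · right; rw [f20, f21]; omega
    · rintro hi3 v ⟨u, hu, rfl⟩
      have h := sepOutCorrQFinset_subset hR hRR' hR'R (Finset.mem_coe.1 hu)
      obtain ⟨-, -, -, -, -, -, f30, f31, -, -, f50, f51⟩ := frameIso_apply_formula u
      simp only [hM, Finset.mem_coe, Finset.mem_filter, mem_triBall_iff, triNorm_frameIso i hi]
      push_cast
      refine ⟨h.2.1, h.1, ?_⟩
      rcases hi3 with rfl | rfl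
      · left; rw [f30, f31]; omega
      · right; rw [f50, f51]; omega
  -- supports of the pairs
  have dOpen : DeterminedBy (extOpenDuoQ n R) (↑S ∪ ↑P) :=
    (determinedBy_extOpenDuoQ hnR).mono (extDuoConeSet_subset (n := n) (R := R) (R' := R') (by omega))
  have hSM3 : frameIso 3 '' (↑S ∪ ↑P : Set (Site 2)) ⊆ ↑S ∪ ↑M := by
    rintro v ⟨u, hu, rfl⟩
    obtain ⟨-, -, -, -, -, -, f30, f31, -⟩ := frameIso_apply_formula u
    simp only [hS, hP, hM, Set.mem_union, Finset.mem_coe, Finset.mem_filter, mem_triBall_iff,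
      triNorm_frameIso 3 (by norm_num)] at hu ⊢
    rw [f30, f31]
    rcases hu with hu | hu
    · exact Or.inl hu
    · right; refine ⟨hu.1, hu.2.1, ?_⟩; omega
  have dClosed : DeterminedBy (extClosedDuoQ n R) (↑S ∪ ↑M) :=
    (DeterminedBy.preimage_compl' (determinedBy_preimage_frameConfig 3 dOpen)).mono hSM3
  -- the events
  set Ap : Set (SiteConfig (Site 2)) := extOpenDuoQ n R with hAp
  set Am : Set (SiteConfig (Site 2)) := extClosedDuoQ n R with hAm
  set Bp : Set (SiteConfig (Site 2)) := C ∩ {ω | frameConfig 2 ω ∈ C} with hBp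
  set Bm : Set (SiteConfig (Site 2)) := {ω | frameConfig 3 ωᶜ ∈ C} ∩ {ω | frameConfig 5 ωᶜ ∈ C} with hBm
  have huC := isUpperSet_sepOutCorrQ R R'
  have upre : ∀ {F : Set (SiteConfig (Site 2))}, IsUpperSet F → ∀ i, IsUpperSet {ω : SiteConfig (Site 2) | frameConfig i ω ∈ F} :=
    fun hF i ω ω' h hω => hF (frameConfig_mono i h) hω
  have lpre : ∀ {F : Set (SiteConfig (Site 2))}, IsUpperSet F → ∀ i, IsLowerSet {ω : SiteConfig (Site 2) | frameConfig i ωᶜ ∈ F} :=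
    fun hF i ω ω' h hω => hF (frameConfig_mono i (Set.compl_subset_compl.2 h)) hω
  have hAp_up : IsUpperSet Ap := isUpperSet_extOpenDuoQ n R
  have hAm_lo : IsLowerSet Am := isLowerSet_extClosedDuoQ n R
  have hBp_up : IsUpperSet Bp := huC.inter (upre huC 2)
  have hBm_lo : IsLowerSet Bm := (lpre huC 3).inter (lpre huC 5)
  -- locality of the corridors
  have dC := determinedBy_sepOutCorrQ R R'
  have dCf := fun i => determinedBy_frame_sepOutCorrQ i R R'
  have hC0 : {ω : SiteConfig (Site 2) | frameConfig 0 ω ∈ C} = C := by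
    ext ω; simp only [Set.mem_setOf_eq]
    have : frameConfig 0 ω = ω := by ext v; rw [mem_frameConfig]; rfl
    rw [this]
  have dBp : DeterminedBy Bp ↑P := by
    refine DeterminedBy.inter ?_ ((dCf 2).1.mono ((corrSup 2 (by norm_num)).1 (Or.inr rfl)))
    have := (dCf 0).1.mono ((corrSup 0 (by norm_num)).1 (Or.inl rfl))
    rwa [hC0] at this
  have dBm : DeterminedBy Bm ↑M :=
    ((dCf 3).2.mono ((corrSup 3 (by norm_num)).2 (Or.inl rfl))).inter ((dCf 5).2.mono ((corrSup 5 (by norm_num)).2 (Or.inr rfl)))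
  have fkg := triSitePercolation_locallyMonotone_fkg p hSP hSM hPM hAp_up hAm_lo hBp_up hBm_lo dOpen dClosed dBp dBm
  -- the corridor probabilities
  have hcorr : ∀ q : unitInterval, (q = p ∨ q = unitInterval.symm p) → c ^ 95 ≤ (triSitePercolation q).real C :=
    fun q hq => le_real_sepOutCorrQ_at q (hrsw q hq) hρ hc hR hRR' hR'R hcap
  set F := sepOutCorrQFinset R R' with hF
  have hBp_ge : (c ^ 95) ^ 2 ≤ (triSitePercolation p).real Bp := by
    have h2 : (triSitePercolation p).real {ω : SiteConfig (Site 2) | frameConfig 2 ω ∈ C} = (triSitePercolation p).real C :=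
      real_preimage_frameConfig p 2 C
    have dC' : DeterminedBy C ↑F := dC
    have d2' : DeterminedBy {ω : SiteConfig (Site 2) | frameConfig 2 ω ∈ C} ↑(F.image (frameIso 2)) := by
      rw [Finset.coe_image]; exact (dCf 2).1
    have har := sitePercolation_harris' p dC' d2' huC (upre huC 2)
    unfold triSitePercolation at h2 hcorr ⊢
    rw [h2] at har
    have h1 := hcorr p (Or.inl rfl)
    calc (c ^ 95) ^ 2 = c ^ 95 * c ^ 95 := sq _
      _ ≤ (sitePercolation (Site 2) p).real C * (sitePercolation (Site 2) p).real C :=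
          mul_le_mul h1 h1 (pow_nonneg hc _) measureReal_nonneg
      _ ≤ _ := har
  have hBm_ge : (c ^ 95) ^ 2 ≤ (triSitePercolation p).real Bm := by
    set q := unitInterval.symm p with hq
    have heq : Bm = compl ⁻¹' ({χ : SiteConfig (Site 2) | frameConfig 3 χ ∈ C} ∩ {χ | frameConfig 5 χ ∈ C}) := by
      ext ω; simp only [hBm, Set.mem_inter_iff, Set.mem_setOf_eq, Set.mem_preimage]
    have hcmp := sitePercolation_real_preimage_compl p ({χ : SiteConfig (Site 2) | frameConfig 3 χ ∈ C} ∩ {χ | frameConfig 5 χ ∈ C})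
    have h3 : (triSitePercolation q).real {ω : SiteConfig (Site 2) | frameConfig 3 ω ∈ C} = (triSitePercolation q).real C :=
      real_preimage_frameConfig q 3 C
    have h5 : (triSitePercolation q).real {ω : SiteConfig (Site 2) | frameConfig 5 ω ∈ C} = (triSitePercolation q).real C :=
      real_preimage_frameConfig q 5 C
    have d3' : DeterminedBy {ω : SiteConfig (Site 2) | frameConfig 3 ω ∈ C} ↑(F.image (frameIso 3)) := by
      rw [Finset.coe_image]; exact (dCf 3).1
    have d5' : DeterminedBy {ω : SiteConfig (Site 2) | frameConfig 5 ω ∈ C} ↑(F.image (frameIso 5)) := by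
      rw [Finset.coe_image]; exact (dCf 5).1
    have har := sitePercolation_harris' q d3' d5' (upre huC 3) (upre huC 5)
    unfold triSitePercolation at h3 h5 hcorr hcmp ⊢
    rw [h3, h5] at har
    rw [heq, hcmp]
    have h1 := hcorr q (Or.inr rfl)
    calc (c ^ 95) ^ 2 = c ^ 95 * c ^ 95 := sq _
      _ ≤ (sitePercolation (Site 2) q).real C * (sitePercolation (Site 2) q).real C :=
          mul_le_mul h1 h1 (pow_nonneg hc _) measureReal_nonneg
      _ ≤ _ := har
  -- assemble
  have hAA : extFourAdjQ n R = Ap ∩ Am := rfl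
  have hsub := extFourAdjQ_inter_corr_subset (n := n) hR hnR hRR' hR'R
  have h0 : 0 ≤ (triSitePercolation p).real (extFourAdjQ n R) := measureReal_nonneg
  calc (triSitePercolation p).real (extFourAdjQ n R) * (c ^ 95) ^ 4
      = (triSitePercolation p).real (extFourAdjQ n R) * ((c ^ 95) ^ 2 * (c ^ 95) ^ 2) := by ring
    _ ≤ (triSitePercolation p).real (Ap ∩ Am) * ((triSitePercolation p).real Bp * (triSitePercolation p).real Bm) := by
        rw [hAA]
        exact mul_le_mul_of_nonneg_left (mul_le_mul hBp_ge hBm_ge (by positivity) measureReal_nonneg) (by rw [← hAA]; exact h0)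
    _ ≤ (triSitePercolation p).real (Ap ∩ Am ∩ (Bp ∩ Bm)) := fkg
    _ ≤ (triSitePercolation p).real (extFourAdjQ n R') := by
        refine measureReal_mono ?_ (measure_ne_top _ _)
        intro ω hω
        exact hsub ⟨hω.1, hω.2.1, hω.2.2⟩

end Literature.Probability.Percolation
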